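import Mathlib
import Literature.Probability.LatticeModels.TorusFourierWeightedL1ProdWeight
import Literature.Probability.LatticeModels.TorusFourierFirstMoment
import HarnessLib

/-!
# MOMENTS of a space-time character sum: a monomial weight inside the `ℓ¹` sum, paid by mixed differences (product weight)

Topic `Probability/LatticeModels`; sequel of `TorusFourierWeightedL1ProdWeight.lean` (the `ℓ¹` norm `Σ_{a,b} ‖S[G](a,b)‖` of a product-torus
character sum `S[G](a,b) = Σ_{p,p'} χ_p(a)χ_{p'}(b) G(p,p')` from the PRODUCT weight
`W(a,b) = (1 + c₀X^{2N₀})(1 + c₁Y₁^{2N₁})(1 + c₂Y₂^{2N₂})`, `X = 4|ã_u(a)|/L₁`, `Y_i = 4|b̃_{v_i}(b)|/L₂`) and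
`TorusFourierWeightedL1Mixed.lean` (each mixed monomial `X^{2n₀}Y₁^{2n₁}Y₂^{2n₂}‖S[G]‖²` is paid by the `ℓ²` norm of the mixed difference
`Δ_u^{n₀}Δ_{v₁}^{n₁}Δ_{v₂}^{n₂}G`).  Here a MONOMIAL `m(a,b) = X^{n₀}Y₁^{n₁}Y₂^{n₂}` is carried INSIDE the `ℓ¹` sum — the position-space
moments of a lattice propagator (`n = (1,0,0)`: the time moment; `(0,1,0)`, `(0,0,1)`: the space moments), as needed by the weighted
(`1 + diam`) Gram–Hadamard bounds of the renormalisation-group step (Benfatto–Giuliani–Mastropietro 2006, (2.36aa)/(3.3): moments of the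
single-scale propagator ↔ smoothness of its symbol; cell gate-hubbard-kl, K3 ENGINE (E4)₀ design of record, k3c2-p1 g3 SPEC P1):

* **`sum_sum_prodWeight_monomial_mul_norm_sq_le`** — `Σ_{a,b} W·m²·‖S[G]‖² ≤ L₁^{d₁}L₂^{d₂}·Σ_{e∈{0,1}³} c₀^{e₀}c₁^{e₁}c₂^{e₂}·
  Σ‖Δ_u^{n₀+e₀N₀}Δ_{v₁}^{n₁+e₁N₁}Δ_{v₂}^{n₂+e₂N₂}G‖²` (expand `W·m²` into eight mixed monomials);
* **`sum_sum_monomial_mul_norm_prodChar_le_prodWeight`** — `Σ_{a,b} m·‖S[G]‖ ≤ (Σ_{a,b} W⁻¹)^{1/2}·(that)^{1/2}` (Cauchy–Schwarz with `W`);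
* `sum_sum_inv_prodWeight_eq_mul` — the inverse weight sum FACTORISES: `Σ_{a,b} W⁻¹ = (Σ_a (1+c₀X^{2N₀})⁻¹)·(Σ_b ((1+c₁Y₁^{2N₁})(1+c₂Y₂^{2N₂}))⁻¹)`;
  `sum_prod_inv_one_add_valMinAbs_div_sq_le` — for the two AXIS directions of `(ℤ/Lℤ)²` at an integer scale `R ≥ 1`,
  `Σ_b ∏_i (1+(b̃_i/R)²)⁻¹ ≤ 36R²` (square of `TorusFourierFirstMoment.sum_inv_one_add_valMinAbs_div_sq_le`).

Everything is proved; no definitions, no named facts.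

## Sources

G. Benfatto, A. Giuliani, V. Mastropietro, Ann. Henri Poincaré 7 (2006) 809–898, Lemma 2.2, (2.36aa), (3.3) and footnote ¹
(`BenfattoGiulianiMastropietro2006`); S. Friedli, Y. Velenik, *Statistical Mechanics of Lattice Systems* (2017), §10.4
(`FriedliVelenik2017`).
-/

noncomputable section

open Finset Complex
open scoped Real ComplexConjugate

namespace Literature.Probability.LatticeModels

variable {d₁ L₁ d₂ L₂ : ℕ} [NeZero L₁] [NeZero L₂]

omit [NeZero L₁] [NeZero L₂] in
/-- `(1 + c₀x^{2N₀})(1 + c₁y^{2N₁})(1 + c₂z^{2N₂})·((x^{n₀}y^{n₁}z^{n₂})²·T) = Σ_{e∈{0,1}³} c₀^{e₀}c₁^{e₁}c₂^{e₂}·x^{2(n₀+e₀N₀)}y^{2(n₁+e₁N₁)}z^{2(n₂+e₂N₂)}·T`.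
[cite: BenfattoGiulianiMastropietro2006, (2.36aa)] -/
private theorem prodWeight_monomial_expand (x y z c₀ c₁ c₂ T : ℝ) (n₀ n₁ n₂ N₀ N₁ N₂ : ℕ) :
    (1 + c₀ * x ^ (2 * N₀)) * (1 + c₁ * y ^ (2 * N₁)) * (1 + c₂ * z ^ (2 * N₂)) * ((x ^ n₀ * y ^ n₁ * z ^ n₂) ^ 2 * T) =
      ∑ e : Fin 2 × Fin 2 × Fin 2, c₀ ^ (e.1 : ℕ) * c₁ ^ (e.2.1 : ℕ) * c₂ ^ (e.2.2 : ℕ) *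
        (x ^ (2 * (n₀ + (e.1 : ℕ) * N₀)) * (y ^ (2 * (n₁ + (e.2.1 : ℕ) * N₁)) * (z ^ (2 * (n₂ + (e.2.2 : ℕ) * N₂)) * T))) := by
  simp only [Fintype.sum_prod_type, Fin.sum_univ_two, Fin.val_zero, Fin.val_one, pow_zero, pow_one, zero_mul, one_mul,
    add_zero]
  ring

omit [NeZero L₁] [NeZero L₂] in
/-- Cauchy–Schwarz with a positive weight (local copy). [cite: BenfattoGiulianiMastropietro2006, Lemma 2.2 and footnote 1] -/
private theorem sum_norm_le_of_weight₃ {ι : Type*} (s : Finset ι) (g : ι → ℂ) (W : ι → ℝ) (hW : ∀ x ∈ s, 0 < W x) :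
    ∑ x ∈ s, ‖g x‖ ≤ Real.sqrt (∑ x ∈ s, (W x)⁻¹) * Real.sqrt (∑ x ∈ s, W x * ‖g x‖ ^ 2) := by
  have hcs := sum_mul_sq_le_sq_mul_sq s (fun x => Real.sqrt ((W x)⁻¹)) (fun x => Real.sqrt (W x) * ‖g x‖)
  have hprod : ∀ x ∈ s, Real.sqrt ((W x)⁻¹) * (Real.sqrt (W x) * ‖g x‖) = ‖g x‖ := by
    intro x hx
    rw [← mul_assoc, Real.sqrt_inv, inv_mul_cancel₀ (Real.sqrt_ne_zero'.2 (hW x hx)), one_mul]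
  have h1 : ∀ x ∈ s, Real.sqrt ((W x)⁻¹) ^ 2 = (W x)⁻¹ := fun x hx => Real.sq_sqrt (inv_nonneg.2 (hW x hx).le)
  have h2 : ∀ x ∈ s, (Real.sqrt (W x) * ‖g x‖) ^ 2 = W x * ‖g x‖ ^ 2 := fun x hx => by
    rw [mul_pow, Real.sq_sqrt (hW x hx).le]
  rw [sum_congr rfl hprod, sum_congr rfl h1, sum_congr rfl h2] at hcs
  have hA : 0 ≤ ∑ x ∈ s, (W x)⁻¹ := sum_nonneg fun x hx => inv_nonneg.2 (hW x hx).le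
  have hS : 0 ≤ ∑ x ∈ s, ‖g x‖ := sum_nonneg fun x _ => norm_nonneg _
  rw [← Real.sqrt_mul hA, ← Real.sqrt_sq hS]
  exact Real.sqrt_le_sqrt hcs

/-- **Weighted `ℓ²` bound, product weight times a squared monomial**: with `X = 4|ã_u(a)|/L₁`, `Y_i = 4|b̃_{v_i}(b)|/L₂`,
`W = (1 + c₀X^{2N₀})(1 + c₁Y₁^{2N₁})(1 + c₂Y₂^{2N₂})`, `m = X^{n₀}Y₁^{n₁}Y₂^{n₂}` and `c₀, c₁, c₂ ≥ 0`,
`Σ_{a,b} W·(m²·‖S[G](a,b)‖²) ≤ L₁^{d₁}L₂^{d₂}·Σ_{e∈{0,1}³} c₀^{e₀}c₁^{e₁}c₂^{e₂}·Σ_{p,p'} ‖Δ_u^{n₀+e₀N₀}Δ_{v₁}^{n₁+e₁N₁}Δ_{v₂}^{n₂+e₂N₂}G‖²`.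
[cite: BenfattoGiulianiMastropietro2006, Lemma 2.2 and (2.36aa)] -/
theorem sum_sum_prodWeight_monomial_mul_norm_sq_le (G : TorusSite d₁ L₁ → TorusSite d₂ L₂ → ℂ) (u : TorusSite d₁ L₁)
    (v₁ v₂ : TorusSite d₂ L₂) (n₀ n₁ n₂ N₀ N₁ N₂ : ℕ) {c₀ c₁ c₂ : ℝ} (hc₀ : 0 ≤ c₀) (hc₁ : 0 ≤ c₁) (hc₂ : 0 ≤ c₂) :
    ∑ a : TorusSite d₁ L₁, ∑ b : TorusSite d₂ L₂,
        (1 + c₀ * (4 * |((∑ j, u j * a j).valMinAbs : ℝ)| / L₁) ^ (2 * N₀)) *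
          (1 + c₁ * (4 * |((∑ j, v₁ j * b j).valMinAbs : ℝ)| / L₂) ^ (2 * N₁)) *
            (1 + c₂ * (4 * |((∑ j, v₂ j * b j).valMinAbs : ℝ)| / L₂) ^ (2 * N₂)) *
              (((4 * |((∑ j, u j * a j).valMinAbs : ℝ)| / L₁) ^ n₀ * (4 * |((∑ j, v₁ j * b j).valMinAbs : ℝ)| / L₂) ^ n₁ *
                  (4 * |((∑ j, v₂ j * b j).valMinAbs : ℝ)| / L₂) ^ n₂) ^ 2 *
                ‖∑ p, ∑ p', torusChar p a * torusChar p' b * G p p'‖ ^ 2) ≤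
      (L₁ : ℝ) ^ d₁ * (L₂ : ℝ) ^ d₂ * ∑ e : Fin 2 × Fin 2 × Fin 2, c₀ ^ (e.1 : ℕ) * c₁ ^ (e.2.1 : ℕ) * c₂ ^ (e.2.2 : ℕ) *
        ∑ p, ∑ p', ‖((fwdDiff u)^[n₀ + (e.1 : ℕ) * N₀]
          (fun q => ((fwdDiff v₁)^[n₁ + (e.2.1 : ℕ) * N₁] ((fwdDiff v₂)^[n₂ + (e.2.2 : ℕ) * N₂] (G q))) p')) p‖ ^ 2 := by
  -- expand the weight times the squared monomial pointwise into the eight mixed monomials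
  have hpt : ∀ (a : TorusSite d₁ L₁) (b : TorusSite d₂ L₂),
      (1 + c₀ * (4 * |((∑ j, u j * a j).valMinAbs : ℝ)| / L₁) ^ (2 * N₀)) *
          (1 + c₁ * (4 * |((∑ j, v₁ j * b j).valMinAbs : ℝ)| / L₂) ^ (2 * N₁)) *
            (1 + c₂ * (4 * |((∑ j, v₂ j * b j).valMinAbs : ℝ)| / L₂) ^ (2 * N₂)) *
              (((4 * |((∑ j, u j * a j).valMinAbs : ℝ)| / L₁) ^ n₀ * (4 * |((∑ j, v₁ j * b j).valMinAbs : ℝ)| / L₂) ^ n₁ *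
                  (4 * |((∑ j, v₂ j * b j).valMinAbs : ℝ)| / L₂) ^ n₂) ^ 2 *
                ‖∑ p, ∑ p', torusChar p a * torusChar p' b * G p p'‖ ^ 2) =
        ∑ e : Fin 2 × Fin 2 × Fin 2, c₀ ^ (e.1 : ℕ) * c₁ ^ (e.2.1 : ℕ) * c₂ ^ (e.2.2 : ℕ) *
          ((4 * |((∑ j, u j * a j).valMinAbs : ℝ)| / L₁) ^ (2 * (n₀ + (e.1 : ℕ) * N₀)) *
            ((4 * |((∑ j, v₁ j * b j).valMinAbs : ℝ)| / L₂) ^ (2 * (n₁ + (e.2.1 : ℕ) * N₁)) *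
              ((4 * |((∑ j, v₂ j * b j).valMinAbs : ℝ)| / L₂) ^ (2 * (n₂ + (e.2.2 : ℕ) * N₂)) *
                ‖∑ p, ∑ p', torusChar p a * torusChar p' b * G p p'‖ ^ 2))) :=
    fun a b => prodWeight_monomial_expand _ _ _ c₀ c₁ c₂ _ n₀ n₁ n₂ N₀ N₁ N₂
  simp_rw [hpt]
  conv_lhs => enter [2, a]; rw [Finset.sum_comm]
  rw [Finset.sum_comm, mul_sum]
  refine sum_le_sum fun e _ => ?_
  have hce : 0 ≤ c₀ ^ (e.1 : ℕ) * c₁ ^ (e.2.1 : ℕ) * c₂ ^ (e.2.2 : ℕ) := by positivity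
  have hmix := sum_sum_mixedWeight_mul_norm_sq_le G u v₁ v₂ (n₀ + (e.1 : ℕ) * N₀) (n₁ + (e.2.1 : ℕ) * N₁)
    (n₂ + (e.2.2 : ℕ) * N₂)
  have hpull : ∑ a : TorusSite d₁ L₁, ∑ b : TorusSite d₂ L₂, c₀ ^ (e.1 : ℕ) * c₁ ^ (e.2.1 : ℕ) * c₂ ^ (e.2.2 : ℕ) *
        ((4 * |((∑ j, u j * a j).valMinAbs : ℝ)| / L₁) ^ (2 * (n₀ + (e.1 : ℕ) * N₀)) *
          ((4 * |((∑ j, v₁ j * b j).valMinAbs : ℝ)| / L₂) ^ (2 * (n₁ + (e.2.1 : ℕ) * N₁)) *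
            ((4 * |((∑ j, v₂ j * b j).valMinAbs : ℝ)| / L₂) ^ (2 * (n₂ + (e.2.2 : ℕ) * N₂)) *
              ‖∑ p, ∑ p', torusChar p a * torusChar p' b * G p p'‖ ^ 2))) =
      c₀ ^ (e.1 : ℕ) * c₁ ^ (e.2.1 : ℕ) * c₂ ^ (e.2.2 : ℕ) *
        ∑ a : TorusSite d₁ L₁, ∑ b : TorusSite d₂ L₂,
          (4 * |((∑ j, u j * a j).valMinAbs : ℝ)| / L₁) ^ (2 * (n₀ + (e.1 : ℕ) * N₀)) *
            ((4 * |((∑ j, v₁ j * b j).valMinAbs : ℝ)| / L₂) ^ (2 * (n₁ + (e.2.1 : ℕ) * N₁)) *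
              ((4 * |((∑ j, v₂ j * b j).valMinAbs : ℝ)| / L₂) ^ (2 * (n₂ + (e.2.2 : ℕ) * N₂)) *
                ‖∑ p, ∑ p', torusChar p a * torusChar p' b * G p p'‖ ^ 2)) := by
    rw [mul_sum]
    refine sum_congr rfl fun a _ => ?_
    rw [mul_sum]
  rw [hpull]
  calc c₀ ^ (e.1 : ℕ) * c₁ ^ (e.2.1 : ℕ) * c₂ ^ (e.2.2 : ℕ) *
        ∑ a : TorusSite d₁ L₁, ∑ b : TorusSite d₂ L₂,
          (4 * |((∑ j, u j * a j).valMinAbs : ℝ)| / L₁) ^ (2 * (n₀ + (e.1 : ℕ) * N₀)) *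
            ((4 * |((∑ j, v₁ j * b j).valMinAbs : ℝ)| / L₂) ^ (2 * (n₁ + (e.2.1 : ℕ) * N₁)) *
              ((4 * |((∑ j, v₂ j * b j).valMinAbs : ℝ)| / L₂) ^ (2 * (n₂ + (e.2.2 : ℕ) * N₂)) *
                ‖∑ p, ∑ p', torusChar p a * torusChar p' b * G p p'‖ ^ 2))
      ≤ c₀ ^ (e.1 : ℕ) * c₁ ^ (e.2.1 : ℕ) * c₂ ^ (e.2.2 : ℕ) *
          ((L₁ : ℝ) ^ d₁ * (L₂ : ℝ) ^ d₂ * ∑ p, ∑ p', ‖((fwdDiff u)^[n₀ + (e.1 : ℕ) * N₀]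
            (fun q => ((fwdDiff v₁)^[n₁ + (e.2.1 : ℕ) * N₁] ((fwdDiff v₂)^[n₂ + (e.2.2 : ℕ) * N₂] (G q))) p')) p‖ ^ 2) :=
        mul_le_mul_of_nonneg_left hmix hce
    _ = (L₁ : ℝ) ^ d₁ * (L₂ : ℝ) ^ d₂ * (c₀ ^ (e.1 : ℕ) * c₁ ^ (e.2.1 : ℕ) * c₂ ^ (e.2.2 : ℕ) *
          ∑ p, ∑ p', ‖((fwdDiff u)^[n₀ + (e.1 : ℕ) * N₀]
            (fun q => ((fwdDiff v₁)^[n₁ + (e.2.1 : ℕ) * N₁] ((fwdDiff v₂)^[n₂ + (e.2.2 : ℕ) * N₂] (G q))) p')) p‖ ^ 2) := by ring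

/-- **A position MOMENT of a space-time character sum from mixed symbol differences**: for the monomial
`m(a,b) = X^{n₀}Y₁^{n₁}Y₂^{n₂}` and the product weight `W` as above,
`Σ_{a,b} m(a,b)·‖S[G](a,b)‖ ≤ (Σ_{a,b} W⁻¹)^{1/2} · (L₁^{d₁}L₂^{d₂}·Σ_{e∈{0,1}³} c₀^{e₀}c₁^{e₁}c₂^{e₂}·Σ‖Δ_u^{n₀+e₀N₀}Δ_{v₁}^{n₁+e₁N₁}Δ_{v₂}^{n₂+e₂N₂}G‖²)^{1/2}`
(Cauchy–Schwarz with `W`; e.g. `n = (1,0,0)` the time moment, `n = (0,1,0)` a space moment of a lattice propagator, `N = (1,1,1)`).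
[cite: BenfattoGiulianiMastropietro2006, Lemma 2.2, (2.36aa) and (3.3)] -/
theorem sum_sum_monomial_mul_norm_prodChar_le_prodWeight (G : TorusSite d₁ L₁ → TorusSite d₂ L₂ → ℂ) (u : TorusSite d₁ L₁)
    (v₁ v₂ : TorusSite d₂ L₂) (n₀ n₁ n₂ N₀ N₁ N₂ : ℕ) {c₀ c₁ c₂ : ℝ} (hc₀ : 0 ≤ c₀) (hc₁ : 0 ≤ c₁) (hc₂ : 0 ≤ c₂) :
    ∑ a : TorusSite d₁ L₁, ∑ b : TorusSite d₂ L₂,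
        (4 * |((∑ j, u j * a j).valMinAbs : ℝ)| / L₁) ^ n₀ * (4 * |((∑ j, v₁ j * b j).valMinAbs : ℝ)| / L₂) ^ n₁ *
            (4 * |((∑ j, v₂ j * b j).valMinAbs : ℝ)| / L₂) ^ n₂ *
          ‖∑ p, ∑ p', torusChar p a * torusChar p' b * G p p'‖ ≤
      Real.sqrt (∑ a : TorusSite d₁ L₁, ∑ b : TorusSite d₂ L₂,
          ((1 + c₀ * (4 * |((∑ j, u j * a j).valMinAbs : ℝ)| / L₁) ^ (2 * N₀)) *
            (1 + c₁ * (4 * |((∑ j, v₁ j * b j).valMinAbs : ℝ)| / L₂) ^ (2 * N₁)) *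
              (1 + c₂ * (4 * |((∑ j, v₂ j * b j).valMinAbs : ℝ)| / L₂) ^ (2 * N₂)))⁻¹) *
        Real.sqrt ((L₁ : ℝ) ^ d₁ * (L₂ : ℝ) ^ d₂ *
          ∑ e : Fin 2 × Fin 2 × Fin 2, c₀ ^ (e.1 : ℕ) * c₁ ^ (e.2.1 : ℕ) * c₂ ^ (e.2.2 : ℕ) *
            ∑ p, ∑ p', ‖((fwdDiff u)^[n₀ + (e.1 : ℕ) * N₀]
              (fun q => ((fwdDiff v₁)^[n₁ + (e.2.1 : ℕ) * N₁] ((fwdDiff v₂)^[n₂ + (e.2.2 : ℕ) * N₂] (G q))) p')) p‖ ^ 2) := by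
  set W : TorusSite d₁ L₁ × TorusSite d₂ L₂ → ℝ := fun ab =>
    (1 + c₀ * (4 * |((∑ j, u j * ab.1 j).valMinAbs : ℝ)| / L₁) ^ (2 * N₀)) *
      (1 + c₁ * (4 * |((∑ j, v₁ j * ab.2 j).valMinAbs : ℝ)| / L₂) ^ (2 * N₁)) *
        (1 + c₂ * (4 * |((∑ j, v₂ j * ab.2 j).valMinAbs : ℝ)| / L₂) ^ (2 * N₂)) with hW
  set m : TorusSite d₁ L₁ × TorusSite d₂ L₂ → ℝ := fun ab =>
    (4 * |((∑ j, u j * ab.1 j).valMinAbs : ℝ)| / L₁) ^ n₀ * (4 * |((∑ j, v₁ j * ab.2 j).valMinAbs : ℝ)| / L₂) ^ n₁ *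
      (4 * |((∑ j, v₂ j * ab.2 j).valMinAbs : ℝ)| / L₂) ^ n₂ with hm
  set S : TorusSite d₁ L₁ × TorusSite d₂ L₂ → ℂ := fun ab => ∑ p, ∑ p', torusChar p ab.1 * torusChar p' ab.2 * G p p' with hS
  have hm0 : ∀ ab, 0 ≤ m ab := fun ab => by rw [hm]; positivity
  have hWpos : ∀ ab ∈ (univ : Finset (TorusSite d₁ L₁ × TorusSite d₂ L₂)), 0 < W ab := fun ab _ => by
    rw [hW]
    exact mul_pos (mul_pos (add_pos_of_pos_of_nonneg one_pos (by positivity))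
      (add_pos_of_pos_of_nonneg one_pos (by positivity))) (add_pos_of_pos_of_nonneg one_pos (by positivity))
  -- Cauchy–Schwarz with `W` on `g = m·S`
  have hcs := sum_norm_le_of_weight₃ univ (fun ab => (m ab : ℂ) * S ab) W hWpos
  have hnorm : ∀ ab, ‖(m ab : ℂ) * S ab‖ = m ab * ‖S ab‖ := fun ab => by
    rw [norm_mul, Complex.norm_real, Real.norm_of_nonneg (hm0 ab)]
  simp_rw [hnorm] at hcs
  rw [← univ_product_univ, sum_product, sum_product, sum_product] at hcs
  refine hcs.trans (mul_le_mul_of_nonneg_left (Real.sqrt_le_sqrt ?_) (Real.sqrt_nonneg _))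
  have h := sum_sum_prodWeight_monomial_mul_norm_sq_le G u v₁ v₂ n₀ n₁ n₂ N₀ N₁ N₂ hc₀ hc₁ hc₂
  have hsq : ∀ (a : TorusSite d₁ L₁) (b : TorusSite d₂ L₂), W (a, b) * (m (a, b) * ‖S (a, b)‖) ^ 2 =
      W (a, b) * ((m (a, b)) ^ 2 * ‖S (a, b)‖ ^ 2) := fun a b => by rw [mul_pow]
  simp_rw [hsq]
  simp only [hW, hS, hm] at h ⊢
  exact h

/-! ### The inverse weight sums -/

omit [NeZero L₁] [NeZero L₂] in
/-- **The inverse product weight FACTORISES**: `Σ_{a,b} ((1+c₀X(a))(1+c₁Y₁(b))(1+c₂Y₂(b)))⁻¹ = (Σ_a (1+c₀X(a))⁻¹)·(Σ_b ((1+c₁Y₁(b))(1+c₂Y₂(b)))⁻¹)`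
(any functions `X` of `a` and `Y₁, Y₂` of `b`). [cite: BenfattoGiulianiMastropietro2006, Lemma 2.2 and footnote 1] -/
theorem sum_sum_inv_prodWeight_eq_mul {α β : Type*} [Fintype α] [Fintype β] (F : α → ℝ) (H : β → ℝ) :
    ∑ a : α, ∑ b : β, (F a * H b)⁻¹ = (∑ a : α, (F a)⁻¹) * ∑ b : β, (H b)⁻¹ := by
  rw [sum_mul_sum]
  refine sum_congr rfl fun a _ => sum_congr rfl fun b _ => ?_
  rw [mul_inv]

/-- **The two-axis spatial weight sum at an integer scale `R ≥ 1`**: on `(ℤ/Lℤ)²`,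
`Σ_b ∏_i (1 + (b̃_i/R)²)⁻¹ = (Σ_{x ∈ ℤ/Lℤ} (1 + (x̃/R)²)⁻¹)² ≤ 36R²`. [cite: BenfattoGiulianiMastropietro2006, Lemma 2.2 and footnote 1] -/
theorem sum_prod_inv_one_add_valMinAbs_div_sq_le {L : ℕ} [NeZero L] {R : ℕ} (hR : 1 ≤ R) :
    ∑ b : TorusSite 2 L, ∏ i : Fin 2, (1 + (((b i).valMinAbs : ℝ) / R) ^ 2)⁻¹ ≤ 36 * (R : ℝ) ^ 2 := by
  set f : ZMod L → ℝ := fun x => (1 + ((x.valMinAbs : ℝ) / R) ^ 2)⁻¹ with hf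
  have hf0 : ∀ x, 0 ≤ f x := fun x => by rw [hf]; positivity
  have hfac : ∑ b : TorusSite 2 L, ∏ i : Fin 2, f (b i) = (∑ x : ZMod L, f x) ^ 2 := by
    have h := Finset.prod_univ_sum (fun _ : Fin 2 => (univ : Finset (ZMod L))) (fun _ x => f x)
    rw [Fintype.piFinset_univ] at h
    rw [← h, prod_const, card_univ, Fintype.card_fin]
  have hS : ∑ x : ZMod L, f x ≤ 6 * (R : ℝ) := by
    have := sum_inv_one_add_valMinAbs_div_sq_le (L := L) hR
    simpa only [hf, one_div] using this
  have hS0 : 0 ≤ ∑ x : ZMod L, f x := sum_nonneg fun x _ => hf0 x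
  calc ∑ b : TorusSite 2 L, ∏ i : Fin 2, (1 + (((b i).valMinAbs : ℝ) / R) ^ 2)⁻¹
      = (∑ x : ZMod L, f x) ^ 2 := hfac
    _ ≤ (6 * (R : ℝ)) ^ 2 := pow_le_pow_left₀ hS0 hS 2
    _ = 36 * (R : ℝ) ^ 2 := by ring

end Literature.Probability.LatticeModels

end
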